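import Literature.AnabelianGeometry.EtaleTheta.ThetaRigidityToyTwistedGroup
import Mathlib.GroupTheory.SpecificGroups.Cyclic
import HarnessLib

/-!
# The level-`2` twisted toy of the [EtTh] §2 interface `RigidData` (two Galois-conjugate theta
# cocycles whose difference does not extend from `Π^tp_Ÿ` to `Π^tp_Y`)

Cell `abc-iut`; companion of `ThetaRigidityToyTwistedGroup.lean` (the group `P = ((𝔽₂⁴ ⋊ C₂) × C₂) ⋊ ℤ`)
and consumed by `ThetaRigiditySchemaWitnessTwisted.lean` (schema witnesses for FACT rows F-0621
`Cor218_ii`, F-0632 `Prop214_ii`).  Here: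

* `RigidData.ToyTw.toy : RigidData 2 1` — `Π^tp_X := P` (discrete), `G_K := 1`, `μ_2 := ℤ/2` (trivial
  action), `Π^tp_Y := Ker(P ↠ ℤ)`, `Π^tp_Ÿ := Ker(epsP) ∩ Π^tp_Y` (`C₂`-exponent trivial),
  `(l·Δ_Θ) := L` (the central copy of `C₂`), `Ker(Π ↠ Π^Θ) := 1`, `thetaMod :=` the `L`-coordinate, and
  TWO theta cocycles `η₁ = u₁ · ℓ`, `η₂ = v₁ · ℓ` (the `u₁`- resp. `v₁`-coordinate of the `𝔽₂⁴`-part times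
  the `L`-coordinate); `η₂ = η₁ ∘ Ad(x⁻¹)` for `x = (1, 1_ℤ)`, so the two theta sections are
  `(l·ℤ)`-conjugate (`thetaSections_conj` holds via the `gal` constructor), and EVERY interface axiom holds.
* the key computations `e1_conj_x` / `e2_conj_x` (conjugation by `x` swaps `η₁ ↔ η₂`) and the
  obstruction datum: `e1 g₀ · e2 g₀ = 1` but `e1 (y g₀ y⁻¹) · e2 (y g₀ y⁻¹) = g ≠ 1` for the elements
  `g₀ ∈ Π^tp_Ÿ`, `y ∈ Π^tp_Y` of the group file — so `η₁/η₂` is not invariant under `Π^tp_Y`-conjugation,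
  hence is the restriction of NO homomorphism `Π^tp_Y → μ_2`.

Honest framing: a toy of a lawless interface; nothing here is a statement about [EtTh] (refereed) or
about the genuine model of lane C2.  Written by the cell `abc-iut` (seat abc-iut-w5-d175; F-TRANCHES
146/149 of D-0078 (S1)).  No side taken on [IUTchIII] Cor. 3.12; typed ≠ proved.  No instances (the
discrete topology on `P` is supplied as the structure field), no notation.

Reference: [MochizukiEtTh2009] S. Mochizuki, *The étale theta function …*, Publ. RIMS 45 (2009):
Def. 2.13 pp.47–48, Prop. 2.14 (ii) p.49, Cor. 2.18 (ii) p.60 (PRIMS text pages).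
-/

namespace Literature.AnabelianGeometry.EtaleTheta

namespace RigidData

namespace ToyTw

open RigidData.Toy (M2 g g_ne_one)

/-! ## §1. The two cocycle formulas and the `L`-coordinate -/

/-- `e₁(p) := u₁(p) · ℓ(p)` (the `u₁`-coordinate of the `𝔽₂⁴`-part times the `L`-coordinate).
[cite: MochizukiEtTh2009, Def 2.13 p.46] -/
def e1 (p : P) : M2 := p.left.1.left.1.1 * p.left.2

/-- `e₂(p) := v₁(p) · ℓ(p)`. [cite: MochizukiEtTh2009, Def 2.13 p.46] -/
def e2 (p : P) : M2 := p.left.1.left.2.1 * p.left.2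

/-- Conjugation by `x` turns `e₁` into `e₂` on `N`. [cite: MochizukiEtTh2009, Def 2.13 p.47] -/
theorem e1_conj_x (n : N) : e1 (x⁻¹ * SemidirectProduct.inl n * x) = e2 (SemidirectProduct.inl n) := by
  rw [x_inv_mul_inl_mul_x]; rfl

/-- Conjugation by `x` turns `e₂` into `e₁` on `N`. [cite: MochizukiEtTh2009, Def 2.13 p.47] -/
theorem e2_conj_x (n : N) : e2 (x⁻¹ * SemidirectProduct.inl n * x) = e1 (SemidirectProduct.inl n) := by
  rw [x_inv_mul_inl_mul_x]; rfl

/-- `e₁`, `e₂` are multiplicative on `Π^tp_Ÿ`. [cite: MochizukiEtTh2009, Def 2.13 p.46] -/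
theorem e_mul {p q : P} (hp : p ∈ PiYdd) :
    e1 (p * q) = e1 p * e1 q ∧ e2 (p * q) = e2 p * e2 q := by
  rw [mem_PiYdd_iff] at hp
  have h1 : (p * q).left = p.left * q.left := left_mul_of_mem_PiY ((mem_PiY_iff p).mpr hp.2) q
  have h2 : (p.left * q.left).1.left = p.left.1.left * q.left.1.left := vleft_mul_of_right_eq_one hp.1 _
  simp only [e1, e2, h1]
  rw [h2]
  exact ⟨mul_mul_mul_comm _ _ _ _, mul_mul_mul_comm _ _ _ _⟩

/-- THE OBSTRUCTION DATUM: `e₁ g₀ · e₂ g₀ = 1` while `e₁ (y g₀ y⁻¹) · e₂ (y g₀ y⁻¹) = g ≠ 1`.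
[cite: MochizukiEtTh2009, Prop 2.14(ii) p.49] -/
theorem obstruction : e1 g0 * e2 g0 = 1 ∧ e1 (y * g0 * y⁻¹) * e2 (y * g0 * y⁻¹) = g := by
  rw [y_conj_g0]
  exact ⟨rfl, rfl⟩

/-- **No multiplicative map `Π^tp_Y → μ_2` restricts to `η₁·η₂⁻¹ = e₁·e₂` on `Π^tp_Ÿ`** (such a map is
invariant under `Π^tp_Y`-conjugation, `e₁·e₂` is not). [cite: MochizukiEtTh2009, Prop 2.14(ii) p.49] -/
theorem no_hom_restricts (d : PiY → M2) (hd : ∀ p q : PiY, d (p * q) = d p * d q)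
    (hres : ∀ p : P, ∀ hp : p ∈ PiYdd, d ⟨p, hp.2⟩ = e1 p * e2 p) : False := by
  have hy : y ∈ PiY := y_mem_PiY
  have hconj : d ⟨y * g0 * y⁻¹, y_conj_g0_mem_PiYdd.2⟩ = d ⟨g0, g0_mem_PiYdd.2⟩ := by
    have hmul : (⟨y * g0 * y⁻¹, y_conj_g0_mem_PiYdd.2⟩ : PiY) * ⟨y, hy⟩ = ⟨y, hy⟩ * ⟨g0, g0_mem_PiYdd.2⟩ :=
      Subtype.ext (by change y * g0 * y⁻¹ * y = y * g0; rw [inv_mul_cancel_right])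
    have := congrArg d hmul
    rw [hd, hd, mul_comm (d ⟨y, hy⟩)] at this
    exact mul_right_cancel this
  rw [hres _ y_conj_g0_mem_PiYdd, hres _ g0_mem_PiYdd, obstruction.1, obstruction.2] at hconj
  exact g_ne_one hconj

/-- `thetaMod : (l·Δ_Θ) = L ↠ μ_2`, the `L`-coordinate. [cite: MochizukiEtTh2009, Def 2.13 p.46] -/
noncomputable def thetaModL : (L : Subgroup P) →* M2 where
  toFun q := (q.1.left).2
  map_one' := rfl
  map_mul' := by
    rintro ⟨_, m, rfl⟩ ⟨_, m', rfl⟩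
    change ((iotaL m * iotaL m').left).2 = (iotaL m).left.2 * (iotaL m').left.2
    rw [← map_mul]
    rfl

/-- `η₁` on `Π^tp_Ÿ`. [cite: MochizukiEtTh2009, Def 2.13 p.46] -/
def eta1 (q : (PiYdd : Subgroup P)) : M2 := e1 q.1

/-- `η₂` on `Π^tp_Ÿ`. [cite: MochizukiEtTh2009, Def 2.13 p.46] -/
def eta2 (q : (PiYdd : Subgroup P)) : M2 := e2 q.1

/-- `[Π^tp_Y : Π^tp_Ÿ] = 2`. [cite: MochizukiEtTh2009, Def 2.13 p.47] -/
theorem index_PiYdd : ((PiYdd : Subgroup P).subgroupOf PiY).index = 2 := by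
  change (PiYdd : Subgroup P).relIndex PiY = 2
  rw [Subgroup.inf_relIndex_right, Subgroup.relIndex_ker]
  have hmap : (PiY : Subgroup P).map epsP = ⊤ := by
    refine top_le_iff.mp fun c _ => ?_
    exact ⟨SemidirectProduct.inl ((SemidirectProduct.inr c : PiY0), (1 : M2)), (mem_PiY_iff _).mpr rfl, rfl⟩
  rw [hmap, Subgroup.card_top, Nat.card_eq_fintype_card]
  rfl

/-! ## §2. The `ThetaEnvData` part of the toy and the `(l·ℤ)`-conjugacy of its two theta sections -/

/-- `η₁` is multiplicative on `Π^tp_Ÿ`. [cite: MochizukiEtTh2009, Def 2.13 p.46] -/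
theorem eta1_mul (p q : (PiYdd : Subgroup P)) : eta1 (p * q) = eta1 p * eta1 q := (e_mul p.2).1

/-- `η₂` is multiplicative on `Π^tp_Ÿ`. [cite: MochizukiEtTh2009, Def 2.13 p.46] -/
theorem eta2_mul (p q : (PiYdd : Subgroup P)) : eta2 (p * q) = eta2 p * eta2 q := (e_mul p.2).2

/-- **The `ThetaEnvData` part of the level-`2` twisted toy**: `Π^tp_X = P` discrete, `G_K = 1`,
`μ_2 = ℤ/2` with trivial action, `Π^tp_Y`, `Π^tp_Ÿ` as above, theta cocycles `{η₁, η₂}`.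
[cite: MochizukiEtTh2009, Def 2.13 p.47] -/
@[reducible] noncomputable def toyEnv : ThetaEnvData.{0} 2 where
  PiX := P
  topPiX := ⊥
  tgPiX := @topologicalGroup_of_discreteTopology P ⊥ _ (discreteTopology_bot P)
  G := PUnit
  aug := 1
  aug_surjective := fun _ => ⟨1, Subsingleton.elim _ _⟩
  PiY := PiY
  PiY_normal := inferInstance
  PiY_open := @isOpen_discrete _ ⊥ (discreteTopology_bot _) _
  galYX := QuotientGroup.quotientKerEquivOfSurjective
    (SemidirectProduct.rightHom : P →* Multiplicative ℤ) SemidirectProduct.rightHom_surjective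
  PiYdd := PiYdd
  PiYdd_le := inf_le_right
  PiYdd_normal := inferInstance
  PiYdd_open := @isOpen_discrete _ ⊥ (discreteTopology_bot _) _
  index_PiYdd := index_PiYdd
  mu := M2
  mu_cyclic := inferInstance
  card_mu := rfl
  chi := 1
  chi_ker_open := @isOpen_discrete _ ⊥ (discreteTopology_bot _) _
  thetaCocycles := {eta1, eta2}
  thetaCocycles_nonempty := ⟨eta1, Or.inl rfl⟩
  isCocycle := by
    rintro η hη p q
    rcases hη with rfl | rfl
    · exact eta1_mul p q
    · exact eta2_mul p q
  locallyConstant := fun η _ => by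
    letI : TopologicalSpace P := ⊥
    haveI : DiscreteTopology P := discreteTopology_bot P
    exact IsLocallyConstant.of_discrete η
  mul_coboundary_mem := by
    rintro η hη c
    have hcob : CycEnvelope.coboundary ((1 : P →* PUnit).comp (PiYdd : Subgroup P).subtype)
        (1 : PUnit →* MulAut M2) c = 1 := funext fun _ => mul_inv_cancel c
    rw [hcob, mul_one]
    exact hη

/-- `η₁` is a theta cocycle of the toy. [cite: MochizukiEtTh2009, Def 2.13 p.47] -/
theorem eta1_mem : eta1 ∈ toyEnv.thetaCocycles := Or.inl rfl

/-- `η₂` is a theta cocycle of the toy. [cite: MochizukiEtTh2009, Def 2.13 p.47] -/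
theorem eta2_mem : eta2 ∈ toyEnv.thetaCocycles := Or.inr rfl

/-- An element of `Π^tp_Ÿ` is `(n, 0)`. [cite: MochizukiEtTh2009, Def 2.13 p.47] -/
theorem coe_eq_inl (q : (PiYdd : Subgroup P)) : (q : P) = SemidirectProduct.inl (q : P).left :=
  eq_inl_of_mem_PiY (Subgroup.mem_inf.mp q.2).2

/-- `η₁(x⁻¹ q x) = η₂(q)`. [cite: MochizukiEtTh2009, Def 2.13 p.47] -/
theorem eta1_conj_x (q : (PiYdd : Subgroup P)) (h : x⁻¹ * (q : P) * x ∈ (PiYdd : Subgroup P)) :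
    eta1 ⟨x⁻¹ * q * x, h⟩ = eta2 q := by
  change e1 (x⁻¹ * (q : P) * x) = e2 (q : P)
  rw [coe_eq_inl q]
  exact e1_conj_x _

/-- `η₂(x⁻¹ q x) = η₁(q)`. [cite: MochizukiEtTh2009, Def 2.13 p.47] -/
theorem eta2_conj_x (q : (PiYdd : Subgroup P)) (h : x⁻¹ * (q : P) * x ∈ (PiYdd : Subgroup P)) :
    eta2 ⟨x⁻¹ * q * x, h⟩ = eta1 q := by
  change e2 (x⁻¹ * (q : P) * x) = e1 (q : P)
  rw [coe_eq_inl q]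
  exact e2_conj_x _

/-- Conjugation by `x` carries the theta section of `η₁` to that of `η₂`.
[cite: MochizukiEtTh2009, Prop 2.14(ii) p.49] -/
theorem conjX_sTheta_eta1 (q : toyEnv.PiYdd) (h : x⁻¹ * (q : P) * x ∈ toyEnv.PiYdd) :
    toyEnv.conjX x (toyEnv.sTheta eta1_mem ⟨x⁻¹ * q * x, h⟩) = toyEnv.sTheta eta2_mem q := by
  refine SemidirectProduct.ext ?_ (Subtype.ext ?_)
  · change (eta1 ⟨x⁻¹ * (q : P) * x, h⟩)⁻¹ = (eta2 q)⁻¹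
    rw [eta1_conj_x]
  · change x * (x⁻¹ * (q : P) * x) * x⁻¹ = q
    group

/-- Conjugation by `x` carries the theta section of `η₂` to that of `η₁`.
[cite: MochizukiEtTh2009, Prop 2.14(ii) p.49] -/
theorem conjX_sTheta_eta2 (q : toyEnv.PiYdd) (h : x⁻¹ * (q : P) * x ∈ toyEnv.PiYdd) :
    toyEnv.conjX x (toyEnv.sTheta eta2_mem ⟨x⁻¹ * q * x, h⟩) = toyEnv.sTheta eta1_mem q := by
  refine SemidirectProduct.ext ?_ (Subtype.ext ?_)
  · change (eta2 ⟨x⁻¹ * (q : P) * x, h⟩)⁻¹ = (eta1 q)⁻¹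
    rw [eta2_conj_x]
  · change x * (x⁻¹ * (q : P) * x) * x⁻¹ = q
    group

/-- The two theta sections are `(l·ℤ)`-conjugate: `s^Θ_{η₂} = Ad(x) ∘ s^Θ_{η₁} ∘ Ad(x⁻¹)`.
[cite: MochizukiEtTh2009, Def 2.13 p.46] -/
theorem isKLConjugate_eta1_eta2 :
    toyEnv.IsKLConjugate (toyEnv.sTheta eta1_mem) (toyEnv.sTheta eta2_mem) := by
  have h := ThetaEnvData.IsKLConjugate.gal (T := toyEnv) (s := ⇑(toyEnv.sTheta eta1_mem))
    (⇑(toyEnv.sTheta eta1_mem)) x ThetaEnvData.IsKLConjugate.base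
  convert h using 1
  funext q
  exact (conjX_sTheta_eta1 q _).symm

/-- Symmetrically, `s^Θ_{η₁} = Ad(x) ∘ s^Θ_{η₂} ∘ Ad(x⁻¹)`. [cite: MochizukiEtTh2009, Def 2.13 p.46] -/
theorem isKLConjugate_eta2_eta1 :
    toyEnv.IsKLConjugate (toyEnv.sTheta eta2_mem) (toyEnv.sTheta eta1_mem) := by
  have h := ThetaEnvData.IsKLConjugate.gal (T := toyEnv) (s := ⇑(toyEnv.sTheta eta2_mem))
    (⇑(toyEnv.sTheta eta2_mem)) x ThetaEnvData.IsKLConjugate.base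
  convert h using 1
  funext q
  exact (conjX_sTheta_eta2 q _).symm

/-! ## §3. The toy `RigidData 2 1` -/

/-- **The level-`2` twisted toy `RigidData`** (`l = 1`): the `ThetaEnvData` `toyEnv` together with
`(l·Δ_Θ) := L` (central), `Ker(Π ↠ Π^Θ) := 1`, `thetaMod :=` the `L`-coordinate, no cusps.  Every
axiom of the interface is satisfied; `thetaSections_conj` is `isKLConjugate_eta1_eta2` / `…_eta2_eta1`.
[cite: MochizukiEtTh2009, Cor 2.18 p.59] -/
@[reducible] noncomputable def toy : RigidData.{0} 2 1 :=
  { toyEnv with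
    thetaKer := ⊥
    thetaKer_normal := inferInstance
    thetaKer_le := bot_le
    lDeltaTheta := L
    thetaKer_le_lDeltaTheta := bot_le
    lDeltaTheta_le := by
      change (L : Subgroup P) ≤ PiYdd ⊓ (1 : P →* PUnit).ker
      rw [MonoidHom.ker_one]
      exact le_inf L_le_PiYdd le_top
    lDeltaTheta_normal := L_normal
    thetaMod := thetaModL
    thetaMod_surjective := fun m => ⟨⟨iotaL m, m, rfl⟩, rfl⟩
    thetaMod_ker := by
      rintro ⟨_, m, rfl⟩
      constructor
      · intro h1
        have hm : m = 1 := h1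
        refine ⟨1, Subgroup.one_mem _, 1, ?_⟩
        change iotaL m = 1 * (1 : P) ^ ((2 : ℕ+) : ℕ)
        rw [hm, map_one, one_mul, one_pow]
      · rintro ⟨k, hk, ⟨_, m', rfl⟩, hq⟩
        rw [Subgroup.mem_bot] at hk
        subst hk
        change iotaL m = 1 * iotaL m' ^ ((2 : ℕ+) : ℕ) at hq
        have hsq : m' ^ ((2 : ℕ+) : ℕ) = 1 := by
          change m' ^ 2 = 1
          rw [pow_two]
          exact M2_mul_self m'
        rw [one_mul, ← map_pow, hsq, map_one] at hq
        change (iotaL m).left.2 = 1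
        rw [hq]
        rfl
    thetaMod_conj := fun p q => by
      obtain ⟨_, m, rfl⟩ := q
      exact congrArg thetaModL (Subtype.ext
        (show p * iotaL m * p⁻¹ = iotaL m by rw [iotaL_comm p m, mul_inv_cancel_right]))
    cocycle_thetaKer := by
      rintro η hη q hq
      have : q = 1 := Subtype.ext ((Subgroup.mem_bot).mp hq)
      subst this
      rcases hη with rfl | rfl <;> rfl
    cocycle_lDeltaTheta := by
      rintro η hη q ⟨m, hm⟩
      have hq : (q : P) = iotaL m := hm.symm
      rcases hη with rfl | rfl
      · change (q : P).left.1.left.1.1 * (q : P).left.2 = (q : P).left.2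
        rw [hq]
        exact one_mul _
      · change (q : P).left.1.left.2.1 * (q : P).left.2 = (q : P).left.2
        rw [hq]
        exact one_mul _
    cuspY := fun _ => ∅
    cuspX := fun _ => ∅
    cuspX_neg := fun _ => rfl
    augYdd_surjective := fun _ => ⟨1, Subsingleton.elim _ _⟩
    thetaSections_conj := by
      intro η η' hη hη'
      rcases hη with rfl | rfl <;> rcases hη' with rfl | rfl
      · exact ThetaEnvData.IsKLConjugate.base
      · exact isKLConjugate_eta1_eta2
      · exact isKLConjugate_eta2_eta1
      · exact ThetaEnvData.IsKLConjugate.base }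

/-- The interface `RigidData 2 1` is inhabited by the twisted toy. [cite: MochizukiEtTh2009, Cor 2.18 p.59] -/
theorem nonempty_rigidData_two : Nonempty (RigidData.{0} 2 1) := ⟨toy⟩

end ToyTw

end RigidData

end Literature.AnabelianGeometry.EtaleTheta
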